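import Literature.MathematicalPhysics.QuantumFieldTheory.Balaban1983to89.TorusGeometry

/-!
# Bałaban's renormalization group for 4-d lattice Yang–Mills — averaging operations and renormalization transformations:
# consistency and vacuity certificates for `Setup.Averaging` / `Setup.RTOp` / `Setup.RTOpI` (`AveragingRT`)

CITATION HEADER (lean-in-tree rule 2026-08-18). Companion to `Setup` v1.3 and `TorusGeometry` (same series, same audit cell
`pub-balaban`, unit b2b-balaban-f1, FOUNDATIONS 1 — NOTATION).  Sources of the NOTIONS typed here:
T. Bałaban, *Comm. Math. Phys.* **95** 17–40 (1984) [Balaban1984PropagatorsI] §1, p. 18 (1.7) (the canonical contours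
`Γ_{y,x}`) and p. 19 ("if `c = ⟨y, y + Le_μ⟩` then `x(c) = x + Le_μ`", the straight contour `[x, x(c)]` of `L` bonds and
`Γ_{c,x} = Γ_{c₋,x} ∪ [x,x(c)] ∪ Γ_{x(c),c₊}` entering the averages (1.8), (1.11)); T. Bałaban, *Comm. Math. Phys.* **98**
17–51 (1985) [Balaban1985Averaging] p. 19 (10) `(Tρ)(V) = ∫ dU δ(Ū V⁻¹) ρ(U)` and (11) (gauge covariance of `U ↦ Ū`);
T. Bałaban, *Comm. Math. Phys.* **109** 249–301 (1987) [Balaban1987RG1] §0, pp. 252–254 (0.3), (0.12), (0.13)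
`(Tρ)(V) = ∫ dU t(V,U) ρ(U)`.
WHAT IS REPRODUCED: no theorem of the series.  This module is the KERNEL CERTIFICATE behind the v1.3 revision of `Setup`
(cell files GAPS.md G-f1-3, DIVERGENCE.md F16/F17): it decides, by proof, which of the schematic hypothesis-structures of
`Setup` that every later module of the transcription consumes (`Averaging`, `RTOp`, `RTOpI`) are INHABITED and which are
EMPTY, so that "theorem under hypotheses `(av : ∀ k, Averaging P k G) (T : ∀ k, RTOp P k G (av k))`" can be told apart from
"theorem about nothing".  Contents (every declaration tagged; all theorems are elementary measure theory / arithmetic,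
[folklore], and sorry-free):
§1 `measure_eq_mass_smul_of_invariant` — on a measurable group, a right-invariant finite measure is `κ(univ) •` any
   left-invariant probability measure (Weil's uniqueness argument via Tonelli; no topology).
§2 product Haar `fieldMeasure` is a probability measure; coordinate projections and coordinatewise left/right translations
   preserve it.
§3 `exists_not_isRT`, `isEmpty_rtOp_of_witnesses` — for ANY measurable Haar-compatible averaging admitting an event of
   conditional probability `p ∈ (0,1)` independent of the average, and any non-negative measurable NON-INTEGRABLE function
   of the coarse field, there is a (signed, non-integrable) density `ρ` with NO `ρ'` satisfying `IsRT avg ρ ρ'`: the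
   Bochner integrals in `IsRT` take the junk value `0` on non-integrable integrands, and testing against bounded `f`
   supported where the non-integrable function is small pins `ρ'` down to `1` a.e. while `∫ ρ' = 0`.  Hence `RTOp`
   (which asks `IsRT` of EVERY `ρ : GaugeField → ℝ`) is empty.
§4 the straight line of `L` bonds from the centre of `B(c₋)` to the centre of `B(c₊)` (the straight contour `[x, x(c)]`
   of B5 p. 19 (1.8)/(1.11) for `x` = the anchor point of `B(c₋)`, the anchor being the block CENTRE in the convention of
   B12 (0.1)/(0.3) that `Setup`/`TorusGeometry` use (`emb`); B5 itself parametrises `B(y)` by its CORNER `y`, (1.6) p. 18,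
   and `Γ_{y,x}` (1.7) starts at that corner, so in B5's own labelling the centre-to-centre line is NOT the `x = y` term;
   `lineSite`, `line`), its position inside the two blocks (`lineSite_eq_lo/hi`, standing range
   `j + 1 ≤ m + K` of `Setup.Params`, where `TorusGeometry.sitesPerDir_eq_mul_succ` holds), and the AXIAL (decimation)
   AVERAGE `axialAvg U c = U([x, x(c)])` with its gauge COVARIANCE (B7 (11)) and LOCALITY: `axial : Averaging P j G` —
   so the v1.3 (range-guarded) `Averaging` and the family type `∀ j, Averaging P j G` are INHABITED
   (`nonempty_averaging_family`).  The axial average is NOT Bałaban's weighted average (B7 (15) = B12 (0.12), which needs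
   the group mean `M`, DIVERGENCE F6); it is the crudest operation satisfying the two axioms `Setup` records
   (covariance = B7 (11); locality, which in B7 is a PROPERTY of the definition (15) — the contours `Γ_{c,x}`,
   `x ∈ B(c₋)`, lie in `B(c₋) ∪ B(c₊)` — B7's own "second condition" on averages being the small-field linearisation (14)).
§5 `map_axialAvg` — HAAR COMPATIBILITY `axialAvg_* dU = dV` (by §1: the push-forward is right-invariant — translate the
   last bond of every line — and finite); `restrict_map_axialAvg` — conditioning on the variable of a bond OFF every line
   (`offBond`, needs `d ≥ 2`) changes the law of the average only by the factor `Haar(A)` (by §1 on `G`).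
§6 `isEmpty_rtOp_axial`, `isEmpty_rtOp_family` — VACUITY OF `RTOp`: for every `Averaging` whose operation is the axial
   average (standing range, `d ≥ 2`) and every gauge group carrying a Haar-measurable set `A` with `Haar(A) ∉ {0,1}` and
   a finite measurable non-negative non-integrable function (all infinite compact metrisable groups, e.g. `SU(N)`; NOT
   finite groups), `RTOp P j G av` and `∀ k, RTOp P k G (av k)` are EMPTY.  The witnesses on `G` are hypotheses, not
   constructed here.
§7 `rnTransport`, `isRT_rnTransport`, `rtOpIOfCompatible`, `rtOpIAxial` — the INTEGRABLE-DENSITY renormalization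
   transformation (difference of Radon–Nikodym derivatives of the push-forwards of `ρ^± dU`, Mathlib's `rnDeriv`)
   satisfies `IsRT` for every integrable `ρ` and is positivity preserving: the v1.3 structure `RTOpI` is INHABITED over
   every measurable Haar-compatible averaging, in particular over `axial`.
§8 `no_unguarded_averaging`, `isEmpty_averagingUnguarded_family` — VACUITY OF THE UNGUARDED `Averaging` (v1.0–v1.2):
   beyond the coarsest level (`m + K ≤ j`, both tori degenerate to `2` sites per direction, `blockOf ≡ 0`) covariance and
   locality are jointly unsatisfiable for non-trivial `G` and `d ≥ 2`, so `∀ j, Averaging P j G` was empty before v1.3.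
§9 `stdAvg`, `rtOpIStd`, `nonempty_averaging_rtOpI_family` — a TOTAL averaging family (axial in range, label transport
   beyond) with an `RTOpI` at EVERY level: the migrated hypothesis pair `(av, T : ∀ k, RTOpI P k G (av k))` is jointly
   satisfiable.
Nothing here is specific to `d = 4` or to `SU(N)`; `[MeasurableMul₂ G]` (supplied by `UnitaryModel.RegularGaugeGroup`) is
assumed where translations must be measurable.  Consumers and the migration `RTOp → RTOpI` are listed in GAPS.md G-f1-3.
v1.1 (docstrings only; no declaration, statement or proof changed): the block-anchor clause of §4 / `lineSite` / `axialAvg`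
corrected after the boundary referee's cross-read (cell file GAPS.md C-ref5-7, V1: B5 (1.6) anchors blocks at the corner,
the centre convention is B12's), and the locality docstring of `axialAvg_local` re-sourced to B7 (15) (remark R1 there).
-/

open scoped BigOperators ENNReal
open _root_.MeasureTheory Set Function

namespace Literature.MathematicalPhysics.QuantumFieldTheory.Balaban1983to89

namespace AveragingRT

/-! ## 1. Uniqueness of translation-invariant probability measures on a measurable group -/

section HaarUniqueness

variable {Γ : Type*} [Group Γ] [MeasurableSpace Γ] [MeasurableMul₂ Γ]

/-- On a measurable group, a finite RIGHT-invariant measure `κ` is `κ(Γ) • π` for any LEFT-invariant probability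
measure `π` (Weil's convolution argument: compute `∫∫ 1_A(xy) dκ(x) dπ(y)` in both orders).  Used below with
`π` = product Haar measure. [folklore] -/
theorem measure_eq_mass_smul_of_invariant (π κ : Measure Γ) [IsProbabilityMeasure π] [IsFiniteMeasure κ]
    (hπ : ∀ g : Γ, π.map (fun y => g * y) = π) (hκ : ∀ g : Γ, κ.map (fun x => x * g) = κ) :
    κ = κ univ • π := by
  ext A hA
  have hF : Measurable (fun p : Γ × Γ => A.indicator (fun _ => (1 : ℝ≥0∞)) (p.1 * p.2)) :=
    (measurable_const.indicator hA).comp measurable_mul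
  have hswap := lintegral_lintegral_swap (μ := κ) (ν := π)
    (f := fun x y => A.indicator (fun _ => (1 : ℝ≥0∞)) (x * y)) hF.aemeasurable
  -- inner integral in `y`: `π (x⁻¹ A) = π A`
  have h1 : ∀ x : Γ, ∫⁻ y, A.indicator (fun _ => (1 : ℝ≥0∞)) (x * y) ∂π = π A := by
    intro x
    have hm : Measurable (fun y : Γ => x * y) := measurable_const_mul x
    calc ∫⁻ y, A.indicator (fun _ => (1 : ℝ≥0∞)) (x * y) ∂π
        = ∫⁻ y, A.indicator (fun _ => (1 : ℝ≥0∞)) y ∂(π.map (fun y => x * y)) :=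
          (lintegral_map (measurable_const.indicator hA) hm).symm
      _ = π A := by rw [hπ x, lintegral_indicator_const hA, one_mul]
  -- inner integral in `x`: `κ (A g⁻¹) = κ A`
  have h2 : ∀ y : Γ, ∫⁻ x, A.indicator (fun _ => (1 : ℝ≥0∞)) (x * y) ∂κ = κ A := by
    intro y
    have hm : Measurable (fun x : Γ => x * y) := measurable_mul_const y
    calc ∫⁻ x, A.indicator (fun _ => (1 : ℝ≥0∞)) (x * y) ∂κ
        = ∫⁻ x, A.indicator (fun _ => (1 : ℝ≥0∞)) x ∂(κ.map (fun x => x * y)) :=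
          (lintegral_map (measurable_const.indicator hA) hm).symm
      _ = κ A := by rw [hκ y, lintegral_indicator_const hA, one_mul]
  simp only [h1, h2, lintegral_const, measure_univ, mul_one] at hswap
  rw [Measure.smul_apply, smul_eq_mul, mul_comm]
  exact hswap.symm

end HaarUniqueness

/-! ## 2. The product Haar measure on gauge fields: translations of single coordinates -/

section FieldMeasure

variable {P : Params} {j : ℕ} {G : Type*} [GaugeGroup G] [MeasurableSpace G] [HaarData G]

/-- The Haar datum is a probability measure (field `HaarData.isProb` as an instance). [folklore] -/
instance haar_isProbabilityMeasure : IsProbabilityMeasure (HaarData.haar (G := G)) := HaarData.isProb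

/-- The product Haar measure is a probability measure. [folklore] -/
instance fieldMeasure_isProb : IsProbabilityMeasure (fieldMeasure P j G) := by
  unfold fieldMeasure; exact Measure.pi.instIsProbabilityMeasure _

/-- Evaluation at a bond pushes `dU` to Haar measure. [folklore] -/
theorem measurePreserving_eval (b : PBond P j) :
    MeasurePreserving (fun U : GaugeField P j G => U b) (fieldMeasure P j G) HaarData.haar := by
  unfold fieldMeasure
  exact MeasureTheory.measurePreserving_eval (fun _ : PBond P j => (HaarData.haar : Measure G)) b

/-- A bounded measurable real function on a finite measure space is integrable. [folklore] -/
lemma integrable_of_abs_le {α : Type*} [MeasurableSpace α] {m : Measure α} [IsFiniteMeasure m] {φ : α → ℝ}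
    (hφ : Measurable φ) (C : ℝ) (hC : ∀ x, |φ x| ≤ C) : Integrable φ m :=
  (integrable_const C).mono' hφ.aestronglyMeasurable
    (Filter.Eventually.of_forall (fun x => by rw [Real.norm_eq_abs]; exact hC x))

variable [MeasurableMul₂ G]

/-- Right multiplication of every bond variable by a fixed field `k` preserves `dU` (right-invariance of Haar, factorwise). [folklore] -/
theorem measurePreserving_mulRight (k : PBond P j → G) :
    MeasurePreserving (fun (U : GaugeField P j G) (b : PBond P j) => U b * k b) (fieldMeasure P j G) (fieldMeasure P j G) := by
  unfold fieldMeasure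
  exact measurePreserving_pi (fun _ : PBond P j => (HaarData.haar : Measure G)) (fun _ => HaarData.haar)
    (f := fun b x => x * k b) (fun b => ⟨measurable_mul_const (k b), HaarData.map_mul_right (k b)⟩)

/-- Left multiplication of every bond variable by a fixed field `k` preserves `dU`. [folklore] -/
theorem measurePreserving_mulLeft (k : PBond P j → G) :
    MeasurePreserving (fun (U : GaugeField P j G) (b : PBond P j) => k b * U b) (fieldMeasure P j G) (fieldMeasure P j G) := by
  unfold fieldMeasure
  exact measurePreserving_pi (fun _ : PBond P j => (HaarData.haar : Measure G)) (fun _ => HaarData.haar)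
    (f := fun b x => k b * x) (fun b => ⟨measurable_const_mul (k b), HaarData.map_mul_left (k b)⟩)

end FieldMeasure

/-! ## 3. No renormalization transformation exists on ALL densities (`RTOp` is uninhabited as typed) -/

section Emptiness

variable {P : Params} {j : ℕ} {G : Type*} [GaugeGroup G] [MeasurableSpace G] [HaarData G]

/-- ABSTRACT EMPTINESS THEOREM.  Let `avg` be a measurable, Haar-compatible (`avg_* dU = dV`) averaging, `S` an event of
fine fields which is independent of `avg` with probability `p ∈ (0,1)`, and `h ≥ 0` a measurable, finite but NON-integrable
function of the coarse field.  Then the density `ρ = 1_S (h∘avg + 1)/p − 1_{Sᶜ} (h∘avg)/(1−p)` (non-integrable, so that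
`∫ ρ dU` is the Bochner junk value `0`) admits NO `ρ'` with `IsRT avg ρ ρ'`: testing the identity against bounded `f`
killing the growth of `h` forces `ρ' = 1` a.e., while testing against `f = 1` forces `∫ ρ' dV = 0`. [folklore] -/
theorem exists_not_isRT
    (avg : GaugeField P j G → GaugeField P (j+1) G) (havg : Measurable avg)
    (hmap : (fieldMeasure P j G).map avg = fieldMeasure P (j+1) G)
    (S : Set (GaugeField P j G)) (hS : MeasurableSet S) (p : ℝ) (hp0 : 0 < p) (hp1 : p < 1)
    (hSp : ∀ f : GaugeField P (j+1) G → ℝ, Measurable f → (∃ C : ℝ, ∀ V, |f V| ≤ C) →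
      ∫ U in S, f (avg U) ∂(fieldMeasure P j G) = p * ∫ U, f (avg U) ∂(fieldMeasure P j G))
    (h : GaugeField P (j+1) G → ℝ) (hh : Measurable h) (h0 : ∀ V, 0 ≤ h V)
    (hni : ¬ Integrable h (fieldMeasure P (j+1) G)) :
    ∃ ρ : Density P j G, ∀ ρ' : Density P (j+1) G, ¬ IsRT avg ρ ρ' := by
  set μ := fieldMeasure P j G with hμ
  set ν := fieldMeasure P (j+1) G with hν
  have hmp : MeasurePreserving avg μ ν := ⟨havg, hmap⟩
  -- the density
  let ρ : Density P j G := fun U =>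
    S.indicator (fun U => (h (avg U) + 1) / p) U - Sᶜ.indicator (fun U => h (avg U) / (1 - p)) U
  refine ⟨ρ, fun ρ' hRT => ?_⟩
  have hp1' : 0 < 1 - p := by linarith
  -- (i) `ρ` is not integrable, hence `∫ ρ dU = 0`, hence `∫ ρ' dV = 0`.
  have hρ_not_int : ¬ Integrable ρ μ := by
    intro hρ
    apply hni
    have hcomp : Integrable (h ∘ avg) μ := by
      refine hρ.norm.mono' (hh.comp havg).aestronglyMeasurable (Filter.Eventually.of_forall (fun U => ?_))
      simp only [Function.comp_apply, Real.norm_eq_abs]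
      rw [abs_of_nonneg (h0 _)]
      by_cases hU : U ∈ S
      · have : ρ U = (h (avg U) + 1) / p := by
          simp only [ρ, indicator_of_mem hU, mem_compl_iff, hU, not_true_eq_false, not_false_eq_true,
            indicator_of_notMem, sub_zero]
        rw [this, abs_of_nonneg (div_nonneg (by linarith [h0 (avg U)]) hp0.le), le_div_iff₀ hp0]
        nlinarith [h0 (avg U), hp1]
      · have : ρ U = - (h (avg U) / (1 - p)) := by
          simp only [ρ, hU, not_false_eq_true, indicator_of_notMem, mem_compl_iff, indicator_of_mem, zero_sub]
        rw [this, abs_neg, abs_of_nonneg (div_nonneg (h0 _) hp1'.le), le_div_iff₀ hp1']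
        nlinarith [h0 (avg U), hp0]
    exact (hmp.integrable_comp hh.aestronglyMeasurable).mp hcomp
  have hint_ρ' : ∫ V, ρ' V ∂ν = 0 := by
    have h1 := hRT (fun _ => (1 : ℝ)) measurable_const ⟨1, fun _ => by simp⟩
    simp only [mul_one] at h1
    rw [← hμ, ← hν] at h1
    rw [h1]
    exact integral_undef hρ_not_int
  -- (ii) the identity tested against bounded `f` with `h·f` bounded: `∫ ρ' f dV = ∫ f dV`.
  have key : ∀ f : GaugeField P (j+1) G → ℝ, Measurable f → (∃ C : ℝ, ∀ V, |f V| ≤ C) →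
      (∃ C' : ℝ, ∀ V, |h V * f V| ≤ C') → ∫ V, ρ' V * f V ∂ν = ∫ V, f V ∂ν := by
    intro f hf ⟨C, hC⟩ ⟨C', hC'⟩
    have hC0 : 0 ≤ C := le_trans (abs_nonneg _) (hC default)
    have hC'0 : 0 ≤ C' := le_trans (abs_nonneg _) (hC' default)
    -- test functions
    let φ₁ : GaugeField P (j+1) G → ℝ := fun V => (h V + 1) * f V / p
    let φ₂ : GaugeField P (j+1) G → ℝ := fun V => h V * f V / (1 - p)
    have hφ₁m : Measurable φ₁ := ((hh.add_const 1).mul hf).div_const p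
    have hφ₂m : Measurable φ₂ := (hh.mul hf).div_const (1 - p)
    have hφ₁b : ∀ V, |φ₁ V| ≤ (C' + C) / p := by
      intro V
      simp only [φ₁, abs_div, abs_of_pos hp0]
      rw [div_le_div_iff_of_pos_right hp0, add_mul, one_mul]
      exact le_trans (abs_add_le _ _) (add_le_add (hC' V) (hC V))
    have hφ₂b : ∀ V, |φ₂ V| ≤ C' / (1 - p) := by
      intro V
      simp only [φ₂, abs_div, abs_of_pos hp1']
      rw [div_le_div_iff_of_pos_right hp1']
      exact hC' V
    have hi₁ : Integrable (φ₁ ∘ avg) μ :=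
      integrable_of_abs_le (hφ₁m.comp havg) _ (fun U => hφ₁b (avg U))
    have hi₂ : Integrable (φ₂ ∘ avg) μ :=
      integrable_of_abs_le (hφ₂m.comp havg) _ (fun U => hφ₂b (avg U))
    have hif : Integrable (fun U => f (avg U)) μ := integrable_of_abs_le (hf.comp havg) _ (fun U => hC (avg U))
    have hihf : Integrable (fun U => h (avg U) * f (avg U)) μ :=
      integrable_of_abs_le ((hh.mul hf).comp havg) _ (fun U => hC' (avg U))
    -- rewrite the integrand `ρ U * f (avg U)` as a difference of two indicators
    have hρf : ∀ U, ρ U * f (avg U) = S.indicator (φ₁ ∘ avg) U - Sᶜ.indicator (φ₂ ∘ avg) U := by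
      intro U
      by_cases hU : U ∈ S
      · simp only [ρ, indicator_of_mem hU, mem_compl_iff, hU, not_true_eq_false, not_false_eq_true,
          indicator_of_notMem, sub_zero, Function.comp_apply, φ₁]
        ring
      · simp only [ρ, hU, not_false_eq_true, indicator_of_notMem, mem_compl_iff, indicator_of_mem, zero_sub,
          Function.comp_apply, φ₂]
        ring
    have hS1 : ∫ U, S.indicator (φ₁ ∘ avg) U ∂μ = ∫ U, (h (avg U) + 1) * f (avg U) ∂μ := by
      rw [integral_indicator hS]
      have := hSp φ₁ hφ₁m ⟨_, hφ₁b⟩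
      simp only [Function.comp_apply]
      rw [this]
      simp only [φ₁]
      rw [integral_div, mul_div_cancel₀ _ hp0.ne']
    have hS2 : ∫ U, Sᶜ.indicator (φ₂ ∘ avg) U ∂μ = ∫ U, h (avg U) * f (avg U) ∂μ := by
      rw [integral_indicator hS.compl]
      have hsplit := integral_add_compl hS hi₂
      have := hSp φ₂ hφ₂m ⟨_, hφ₂b⟩
      simp only [Function.comp_apply] at hsplit this ⊢
      have h2 : ∫ U in Sᶜ, φ₂ (avg U) ∂μ = (1 - p) * ∫ U, φ₂ (avg U) ∂μ := by linarith
      rw [h2]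
      simp only [φ₂]
      rw [integral_div, mul_div_cancel₀ _ hp1'.ne']
    have hlhs := hRT f hf ⟨C, hC⟩
    rw [hlhs]
    calc ∫ U, ρ U * f (avg U) ∂μ
        = ∫ U, (S.indicator (φ₁ ∘ avg) U - Sᶜ.indicator (φ₂ ∘ avg) U) ∂μ := by
          exact integral_congr_ae (Filter.Eventually.of_forall hρf)
      _ = ∫ U, (h (avg U) + 1) * f (avg U) ∂μ - ∫ U, h (avg U) * f (avg U) ∂μ := by
          rw [integral_sub (hi₁.indicator hS) (hi₂.indicator hS.compl), hS1, hS2]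
      _ = ∫ U, f (avg U) ∂μ := by
          have : ∫ U, (h (avg U) + 1) * f (avg U) ∂μ
              = ∫ U, h (avg U) * f (avg U) ∂μ + ∫ U, f (avg U) ∂μ := by
            rw [← integral_add hihf hif]
            congr 1; funext U; ring
          rw [this]; ring
      _ = ∫ V, f V ∂ν := by
          rw [← hmap, integral_map havg.aemeasurable hf.aestronglyMeasurable]
  -- (iii) on each truncation `B n = {h ≤ n}` the function `ρ'` equals `1` a.e.
  have hB : ∀ n : ℕ, ∀ᵐ V ∂ν, h V ≤ n → ρ' V = 1 := by
    intro n
    set B : Set (GaugeField P (j+1) G) := {V | h V ≤ n} with hBdef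
    have hBm : MeasurableSet B := measurableSet_le hh measurable_const
    let χ : GaugeField P (j+1) G → ℝ := B.indicator (fun _ => 1)
    have hχm : Measurable χ := measurable_const.indicator hBm
    have hχb : ∀ V, |χ V| ≤ 1 := by
      intro V; by_cases hV : V ∈ B <;> simp [χ, hV]
    have hhχ : ∀ A : Set (GaugeField P (j+1) G), ∀ V, |h V * A.indicator χ V| ≤ n := by
      intro A V
      by_cases hV : V ∈ B
      · by_cases hA : V ∈ A
        · simp only [χ, indicator_of_mem hA, indicator_of_mem hV, mul_one, abs_of_nonneg (h0 V)]
          exact hV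
        · simp [hA]
      · have : χ V = 0 := by simp [χ, hV]
        by_cases hA : V ∈ A <;> simp [hA, this]
    by_cases hB0 : ν B = 0
    · -- nothing to prove off a null set
      rw [ae_iff]
      exact measure_mono_null (fun V hV => by
        simp only [Classical.not_imp, mem_setOf_eq] at hV; exact hV.1) hB0
    -- `ψ = ρ' χ` is integrable since its integral is `ν B ≠ 0`
    have hkeyB : ∫ V, ρ' V * χ V ∂ν = (ν B).toReal := by
      have := key χ hχm ⟨1, hχb⟩ ⟨n, by simpa using hhχ univ⟩
      rw [this]
      simp only [χ]
      rw [integral_indicator_const _ hBm, smul_eq_mul, mul_one]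
      rfl
    have hψi : Integrable (fun V => ρ' V * χ V) ν := by
      by_contra hn
      rw [integral_undef hn] at hkeyB
      exact hB0 ((ENNReal.toReal_eq_zero_iff _).mp hkeyB.symm |>.resolve_right (measure_ne_top ν B))
    have hχi : Integrable χ ν := integrable_of_abs_le hχm 1 hχb
    -- all set integrals of `ψ` and `χ` agree
    have hsets : ∀ A : Set (GaugeField P (j+1) G), MeasurableSet A → ν A < ∞ →
        ∫ V in A, ρ' V * χ V ∂ν = ∫ V in A, χ V ∂ν := by
      intro A hA _
      have h1 := key (A.indicator χ) (hχm.indicator hA)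
        ⟨1, fun V => by by_cases hV : V ∈ A <;> simp [hV, hχb]⟩ ⟨n, hhχ A⟩
      have h2 : ∀ V, ρ' V * A.indicator χ V = A.indicator (fun V => ρ' V * χ V) V := by
        intro V; by_cases hV : V ∈ A <;> simp [hV]
      simp_rw [h2, integral_indicator hA] at h1
      exact h1
    have hae := Integrable.ae_eq_of_forall_setIntegral_eq _ _ hψi hχi hsets
    filter_upwards [hae] with V hV hVB
    have hmem : V ∈ B := hVB
    simp only [χ, indicator_of_mem hmem, mul_one] at hV
    exact hV
  -- (iv) hence `ρ' = 1` a.e., so `∫ ρ' dV = 1`, contradicting (i).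
  have hae1 : ∀ᵐ V ∂ν, ρ' V = 1 := by
    have := ae_all_iff.mpr hB
    filter_upwards [this] with V hV
    exact hV (⌈h V⌉₊) (Nat.le_ceil _)
  have : ∫ V, ρ' V ∂ν = 1 := by
    rw [integral_congr_ae hae1, integral_const, smul_eq_mul, mul_one, probReal_univ]
  rw [hint_ρ'] at this
  exact zero_ne_one this

/-- Hence the v1.2 carrier `RTOp P j G av` has NO inhabitant for any measurable Haar-compatible averaging admitting an
independent event of non-trivial probability, once Haar measure on `G` carries a non-integrable finite function
(pulled back along one coarse bond variable). [folklore] -/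
theorem isEmpty_rtOp_of_witnesses (av : Averaging P j G) (havg : Measurable av.avg)
    (hmap : (fieldMeasure P j G).map av.avg = fieldMeasure P (j+1) G)
    (S : Set (GaugeField P j G)) (hS : MeasurableSet S) (p : ℝ) (hp0 : 0 < p) (hp1 : p < 1)
    (hSp : ∀ f : GaugeField P (j+1) G → ℝ, Measurable f → (∃ C : ℝ, ∀ V, |f V| ≤ C) →
      ∫ U in S, f (av.avg U) ∂(fieldMeasure P j G) = p * ∫ U, f (av.avg U) ∂(fieldMeasure P j G))
    (h : GaugeField P (j+1) G → ℝ) (hh : Measurable h) (h0 : ∀ V, 0 ≤ h V)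
    (hni : ¬ Integrable h (fieldMeasure P (j+1) G)) :
    IsEmpty (RTOp P j G av) := by
  obtain ⟨ρ, hρ⟩ := exists_not_isRT av.avg havg hmap S hS p hp0 hp1 hSp h hh h0 hni
  exact ⟨fun T => hρ (T.T ρ) (T.isRT ρ)⟩

end Emptiness

/-! ## 4. Straight lines through the blocks and the axial (decimation) average -/

section Lines

variable {P : Params} {j : ℕ}

/-- `(L-1)/2 < L`. [folklore] -/
lemma half_lt (P : Params) : (P.L - 1) / 2 < P.L := by have := P.hL.2; omega

/-- `L = 2·((L-1)/2) + 1` (`L` odd). [folklore] -/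
lemma two_mul_half_add_one (P : Params) : 2 * ((P.L - 1) / 2) + 1 = P.L := by
  obtain ⟨k, hk⟩ := P.hL.1; omega

/-- The `t`-th site `emb y + t e_μ` of the straight line issuing from the centre `emb y` of the block `B(y)` (CENTRED
convention B12 (0.1)/(0.3), `TorusGeometry`; B5 (1.6)–(1.7) anchor `B(y)` and `Γ_{y,x}` at the block CORNER instead) in the
direction `μ` of the coarse bond `c = ⟨y, y + e_μ⟩` (`t = 0, …, L`; `t = L` is the centre of the next block). [cite: Balaban1984PropagatorsI, (1.7) p.18] -/
def lineSite (c : PBond P (j+1)) (t : ℕ) : Site P j :=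
  Function.update (emb c.src) c.dir (emb c.src c.dir + t)

/-- The `t`-th fine bond `⟨emb y + t e_μ, emb y + (t+1) e_μ⟩` on the straight line of the coarse bond `c = ⟨y, y + e_μ⟩`. [cite: Balaban1984PropagatorsI, (1.7) p.18] -/
def line (c : PBond P (j+1)) (t : ℕ) : PBond P j := ⟨lineSite c t, c.dir⟩

/-- The line starts at the block centre. [folklore] -/
@[simp] lemma lineSite_zero (c : PBond P (j+1)) : lineSite c 0 = emb c.src := by
  simp [lineSite]

/-- Consecutive line sites differ by one lattice step. [folklore] -/
lemma lineSite_succ (c : PBond P (j+1)) (t : ℕ) : lineSite c (t+1) = (lineSite c t).shift c.dir := by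
  simp only [lineSite, Site.shift, Function.update_idem, Function.update_self]
  push_cast
  rw [add_assoc]

/-- KEY CONGRUENCE of the centred labelling (standing range): `((a+1) mod N_{j+1})·L + r ≡ a·L + L + r (mod N_j)`,
`N_j = N_{j+1}·L`. [folklore] -/
lemma cast_succ_mul_L (hj : j + 1 ≤ P.m + P.K) (a : ZMod (P.sitesPerDir (j+1))) (r : ℕ) :
    (((a + 1).val * P.L + r : ℕ) : ZMod (P.sitesPerDir j)) = ((a.val * P.L + P.L + r : ℕ) : ZMod (P.sitesPerDir j)) := by
  rw [ZMod.natCast_eq_natCast_iff, P.sitesPerDir_eq_mul_succ hj, ZMod.val_add, ZMod.val_one]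
  have h := ((Nat.mod_modEq (a.val + 1) (P.sitesPerDir (j+1))).mul_right' P.L).add_right r
  rw [show a.val * P.L + P.L + r = (a.val + 1) * P.L + r by ring]
  exact h

/-- Offsets (from the lowest label of the block of `c₋`) of the line sites with `t ≤ (L-1)/2`. [folklore] -/
def offLo (P : Params) (μ : Fin P.d) (t : ℕ) (ht : t ≤ (P.L - 1) / 2) : Fin P.d → Fin P.L :=
  fun ν => if ν = μ then ⟨(P.L - 1) / 2 + t, by have := P.hL.2; omega⟩ else ⟨(P.L - 1) / 2, half_lt P⟩

/-- Offsets (from the lowest label of the block of `c₊`) of the line sites with `(L-1)/2 < t ≤ L`. [folklore] -/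
def offHi (P : Params) (μ : Fin P.d) (t : ℕ) (ht : t ≤ P.L) : Fin P.d → Fin P.L :=
  fun ν => if ν = μ then ⟨t - (P.L + 1) / 2, by have := P.hL.2; omega⟩ else ⟨(P.L - 1) / 2, half_lt P⟩

/-- First half of the line (`t ≤ (L-1)/2`) lies in the block `B(c₋)`, with explicit offsets. [folklore] -/
theorem lineSite_eq_lo (hj : j + 1 ≤ P.m + P.K) (c : PBond P (j+1)) {t : ℕ} (ht : t ≤ (P.L - 1) / 2) :
    lineSite c t = Site.blockSite c.src (offLo P c.dir t ht) := by
  have _ := hj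
  funext ν
  by_cases hν : ν = c.dir
  · subst hν
    simp only [lineSite, Function.update_self, Site.blockSite, offLo, if_true, emb]
    push_cast; ring
  · simp only [lineSite, Function.update_of_ne hν, Site.blockSite, offLo, if_neg hν, emb]

/-- Second half of the line (`(L-1)/2 < t ≤ L`) lies in the block `B(c₊)`, with explicit offsets (standing range: this is
where the congruence `cast_succ_mul_L` is used). [folklore] -/
theorem lineSite_eq_hi (hj : j + 1 ≤ P.m + P.K) (c : PBond P (j+1)) {t : ℕ} (ht1 : (P.L - 1) / 2 < t) (ht2 : t ≤ P.L) :
    lineSite c t = Site.blockSite c.tgt (offHi P c.dir t ht2) := by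
  funext ν
  by_cases hν : ν = c.dir
  · subst hν
    simp only [lineSite, Function.update_self, Site.blockSite, offHi, if_true, emb, PBond.tgt, Site.shift]
    rw [cast_succ_mul_L hj]
    have : (c.src c.dir).val * P.L + P.L + (t - (P.L + 1) / 2) = (c.src c.dir).val * P.L + (P.L - 1) / 2 + t := by
      have := P.hL.2; obtain ⟨k, hk⟩ := P.hL.1; omega
    rw [this]; push_cast; ring
  · have htgt : c.tgt ν = c.src ν := by simp [PBond.tgt, Site.shift, Function.update_of_ne hν]
    simp only [lineSite, Function.update_of_ne hν, Site.blockSite, offHi, if_neg hν, emb, htgt]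

/-- The line of `c = ⟨y, y + e_μ⟩` ends at the centre of the next block: `emb y + L e_μ = emb (y + e_μ)` (standing range). [folklore] -/
theorem lineSite_L (hj : j + 1 ≤ P.m + P.K) (c : PBond P (j+1)) : lineSite c P.L = emb c.tgt := by
  rw [lineSite_eq_hi hj c (half_lt P) le_rfl]
  funext ν
  simp only [Site.blockSite, offHi, emb]
  congr 3
  split_ifs
  · simp only; have := P.hL.2; obtain ⟨k, hk⟩ := P.hL.1; omega
  · rfl

/-- `blockSite` is injective in (block label, offset) (standing range). [folklore] -/
theorem blockSite_inj (hj : j + 1 ≤ P.m + P.K) {y y' : Site P (j+1)} {r r' : Fin P.d → Fin P.L}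
    (h : Site.blockSite y r = Site.blockSite y' r') : y = y' ∧ r = r' := by
  have hy : y = y' := by rw [← Site.blockOf_blockSite hj y r, h, Site.blockOf_blockSite hj]
  subst hy
  refine ⟨rfl, funext fun ν => Fin.ext ?_⟩
  have := congrArg (fun x : Site P j => (x ν).val % P.L) h
  simpa only [Site.val_blockSite hj, Nat.mul_add_mod', Nat.mod_eq_of_lt (r ν).isLt, Nat.mod_eq_of_lt (r' ν).isLt]
    using this

/-- LOCALITY OF THE LINE: every site of the line of `c` (`t < L`) lies in `B(c₋)` or in `B(c₊)` (standing range). [folklore] -/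
theorem blockOf_lineSite (hj : j + 1 ≤ P.m + P.K) (c : PBond P (j+1)) {t : ℕ} (ht : t < P.L) :
    blockOf (lineSite c t) = c.src ∨ blockOf (lineSite c t) = c.tgt := by
  by_cases hlo : t ≤ (P.L - 1) / 2
  · left; rw [lineSite_eq_lo hj c hlo, Site.blockOf_blockSite hj]
  · right; rw [lineSite_eq_hi hj c (lt_of_not_ge hlo) ht.le, Site.blockOf_blockSite hj]

/-- The LAST bond `line c (L-1)` of a line is not any earlier bond of any line (standing range). [folklore] -/
theorem line_ne_last (hj : j + 1 ≤ P.m + P.K) (c c' : PBond P (j+1)) {t : ℕ} (ht : t < P.L - 1) :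
    line c t ≠ line c' (P.L - 1) := by
  intro h
  have hL := P.hL.2
  obtain ⟨k, hk⟩ := P.hL.1
  simp only [line, PBond.mk.injEq] at h
  obtain ⟨hs, hdir⟩ := h
  have hlast := lineSite_eq_hi hj c' (t := P.L - 1) (by omega) (by omega)
  by_cases hlo : t ≤ (P.L - 1) / 2
  · rw [lineSite_eq_lo hj c hlo, hlast] at hs
    have := congrFun (blockSite_inj hj hs).2 c.dir
    simp only [offLo, offHi, hdir, if_true, Fin.mk.injEq] at this
    omega
  · rw [lineSite_eq_hi hj c (lt_of_not_ge hlo) (by omega), hlast] at hs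
    have := congrFun (blockSite_inj hj hs).2 c.dir
    simp only [offHi, hdir, if_true, Fin.mk.injEq] at this
    omega

/-- `y ↦ y + e_μ` is injective. [folklore] -/
lemma shift_injective (μ : Fin P.d) : Function.Injective (fun y : Site P (j+1) => y.shift μ) := by
  intro y y' h
  funext ν
  by_cases hν : ν = μ
  · subst hν
    have := congrFun h ν
    simpa [Site.shift] using this
  · have := congrFun h ν
    simpa [Site.shift, Function.update_of_ne hν] using this

/-- The last bonds of distinct lines are distinct (standing range). [folklore] -/
theorem last_injective (hj : j + 1 ≤ P.m + P.K) :
    Function.Injective (fun c : PBond P (j+1) => line c (P.L - 1)) := by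
  intro c c' h
  have hL := P.hL.2
  simp only [line, PBond.mk.injEq] at h
  obtain ⟨hs, hdir⟩ := h
  rw [lineSite_eq_hi hj c (t := P.L - 1) (by omega) (by omega),
    lineSite_eq_hi hj c' (t := P.L - 1) (by omega) (by omega)] at hs
  have htgt := (blockSite_inj hj hs).1
  have hsrc : c.src = c'.src := shift_injective c.dir (by simpa [PBond.tgt, hdir] using htgt)
  cases c; cases c'; simp_all

/-- A bond OFF every line (needs `d ≥ 2`): the lowest-label corner site of the block of `0`, direction `e_0`; its second
coordinate has offset `0 ≠ (L-1)/2`. [folklore] -/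
def offBond (P : Params) (hd : 2 ≤ P.d) (j : ℕ) : PBond P j :=
  ⟨fun _ => (0 : ZMod (P.sitesPerDir j)), ⟨0, by omega⟩⟩

/-- No line passes through `offBond` (standing range, `d ≥ 2`). [folklore] -/
theorem line_ne_offBond (hj : j + 1 ≤ P.m + P.K) (hd : 2 ≤ P.d) (c : PBond P (j+1)) {t : ℕ} (ht : t < P.L) :
    line c t ≠ offBond P hd j := by
  intro h
  have hL := P.hL.2
  obtain ⟨k, hk⟩ := P.hL.1
  simp only [line, offBond, PBond.mk.injEq] at h
  obtain ⟨hs, hdir⟩ := h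
  -- the site `0` of `T^{(j)}` is `blockSite 0 0`
  have h0 : (fun _ => (0 : ZMod (P.sitesPerDir j))) = Site.blockSite (fun _ => (0 : ZMod (P.sitesPerDir (j+1))))
      (fun _ => (⟨0, P.L_pos⟩ : Fin P.L)) := by
    funext ν; simp [Site.blockSite]
  rw [h0] at hs
  obtain ⟨ν₁, hν₁⟩ : ∃ ν : Fin P.d, ν ≠ c.dir :=
    ⟨⟨1, by omega⟩, fun h => by simp [hdir, Fin.ext_iff] at h⟩
  by_cases hlo : t ≤ (P.L - 1) / 2
  · rw [lineSite_eq_lo hj c hlo] at hs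
    have hv := congrArg Fin.val (congrFun (blockSite_inj hj hs).2 ν₁)
    simp only [offLo, if_neg hν₁, Fin.val_mk] at hv
    omega
  · rw [lineSite_eq_hi hj c (lt_of_not_ge hlo) ht.le] at hs
    have hv := congrArg Fin.val (congrFun (blockSite_inj hj hs).2 ν₁)
    simp only [offHi, if_neg hν₁, Fin.val_mk] at hv
    omega

end Lines

section Axial

variable {P : Params} {j : ℕ} {G : Type*} [GaugeGroup G]

/-- Ordered product `U(b₀) U(b₁) ⋯ U(b_{n-1})` of the bond variables along the first `n` bonds of the line of `c`. [cite: Balaban1984PropagatorsI, (1.7) p.18] -/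
def pathProd (U : GaugeField P j G) (c : PBond P (j+1)) : ℕ → G
  | 0 => 1
  | n+1 => pathProd U c n * U (line c n)

/-- THE AXIAL (DECIMATION) AVERAGE `Ū(c) = U(Γ_c)`, the parallel transport of `U` along the straight line of `L` bonds from
the centre of `B(c₋)` to the centre of `B(c₊)` — the crudest averaging operation satisfying the two axioms `Setup` records
(covariance B7 (11); locality, a property of B7's definition (15)); it is the transport `U(Γ_{c,x})` (B7 (9), (15)) along
the one contour of B5 (1.11)/B7 (14) that is a straight segment, `Γ_{c,x} = [x, x(c)]` for `x` = the ANCHOR point of `B(c₋)`,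
the anchor being the block CENTRE in the convention of B12 (0.1)/(0.3) that `Setup`/`TorusGeometry` use (`emb`) — B5 (1.6)
parametrises `B(y)` by its CORNER `y`, where `Γ_{y,x}` (1.7) starts, so in B5's own labelling the centre-to-centre line is
not the `x = y` term — and NOT the weighted average B7 (15) = B12 (0.12) used in the series (which needs the group average
`M`, DIVERGENCE F6).  It serves here as the INHABITANT showing that the axioms of
`Averaging` (range-guarded, v1.3) are consistent, and as the test averaging for the vacuity of `RTOp`. [cite: Balaban1984PropagatorsI, (1.7) p.18] -/
def axialAvg (U : GaugeField P j G) : GaugeField P (j+1) G := fun c => pathProd U c P.L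

/-- Gauge covariance of the partial transports: `(U^u)(b₀⋯b_{n-1}) = u(x₀) U(b₀⋯b_{n-1}) u(x_n)⁻¹`. [cite: Balaban1985Averaging, (11) p.19] -/
theorem pathProd_gaugeAct (u : GaugeTransf P j G) (U : GaugeField P j G) (c : PBond P (j+1)) (n : ℕ) :
    pathProd (GaugeField.gaugeAct u U) c n = u (emb c.src) * pathProd U c n * (u (lineSite c n))⁻¹ := by
  induction n with
  | zero => simp [pathProd]
  | succ n ih =>
    simp only [pathProd, ih, GaugeField.gaugeAct, line, PBond.tgt, lineSite_succ]
    group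

/-- COVARIANCE AXIOM (B7 (11)) for the axial average, in the standing range. [cite: Balaban1985Averaging, (11) p.19] -/
theorem axialAvg_covariant (hj : j + 1 ≤ P.m + P.K) (u : GaugeTransf P j G) (U : GaugeField P j G) :
    axialAvg (GaugeField.gaugeAct u U) = GaugeField.gaugeAct (fun y => u (emb y)) (axialAvg U) := by
  funext c
  simp only [axialAvg, GaugeField.gaugeAct, pathProd_gaugeAct, lineSite_L hj]

/-- LOCALITY for the axial average — the second axiom `Setup.Averaging` records; in B7 it is a PROPERTY of the definition
(15) (the contours `Γ_{c,x}`, `x ∈ B(c₋)`, lie in `B(c₋) ∪ B(c₊)`), B7's own "second condition" on averages being the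
small-field linearisation (14): `Ū(c)` depends only on `U` on bonds issuing from `B(c₋) ∪ B(c₊)` (standing range). [cite: Balaban1985Averaging, (15) p.19] -/
theorem axialAvg_local (hj : j + 1 ≤ P.m + P.K) (U U' : GaugeField P j G) (c : PBond P (j+1))
    (hUU' : ∀ b : PBond P j, (blockOf b.src = c.src ∨ blockOf b.src = c.tgt) → U b = U' b) :
    axialAvg U c = axialAvg U' c := by
  have key : ∀ n, n ≤ P.L → pathProd U c n = pathProd U' c n := by
    intro n hn
    induction n with
    | zero => rfl
    | succ n ih =>
      simp only [pathProd]
      rw [ih (by omega), hUU' (line c n) (blockOf_lineSite hj c (by omega))]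
  exact key P.L le_rfl

/-- THE AXIAL AVERAGE AS AN `Averaging` (Setup v1.3, range-guarded axioms): total in `j`, the two axioms being supplied in the
standing range `j + 1 ≤ m + K` and vacuously (never asked) beyond it.  CONSISTENCY CERTIFICATE for `Averaging` (GAPS G-f1-3,
DIVERGENCE F16): `fun j => axial` inhabits `∀ j, Averaging P j G`, the hypothesis shape of `Flow.av`, `FiniteEpsData.av`, …. [cite: Balaban1985Averaging, (11) p.19] -/
def axial : Averaging P j G where
  avg := axialAvg
  covariant := fun hj => axialAvg_covariant hj
  local_dep := fun hj => axialAvg_local hj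

/-- `axial.avg = axialAvg`. [folklore] -/
@[simp] theorem axial_avg : (axial : Averaging P j G).avg = axialAvg := rfl

/-- The family hypothesis `∀ j, Averaging P j G` of `Flow`/`FiniteEpsData` is inhabited (v1.3). [folklore] -/
theorem nonempty_averaging_family : Nonempty (∀ k, Averaging P k G) := ⟨fun _ => axial⟩

/-- Right-multiplying the LAST bond variable of every line by `g(c)` multiplies the axial average by `g` (standing range). [folklore] -/
theorem axialAvg_mul_last (hj : j + 1 ≤ P.m + P.K) (U : GaugeField P j G) (g : GaugeField P (j+1) G) :
    axialAvg (fun b => U b * Function.extend (fun c : PBond P (j+1) => line c (P.L - 1)) g (fun _ => 1) b)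
      = fun c => axialAvg U c * g c := by
  funext c
  set k : PBond P j → G := Function.extend (fun c : PBond P (j+1) => line c (P.L - 1)) g (fun _ => 1) with hk
  have hk_last : k (line c (P.L - 1)) = g c := (last_injective hj).extend_apply g (fun _ => (1 : G)) c
  have hk_early : ∀ t, t < P.L - 1 → k (line c t) = 1 := by
    intro t ht
    rw [hk, Function.extend_apply']
    rintro ⟨c', hc'⟩
    exact line_ne_last hj c c' ht hc'.symm
  have h1 : ∀ n, n ≤ P.L - 1 → pathProd (fun b => U b * k b) c n = pathProd U c n := by
    intro n hn
    induction n with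
    | zero => rfl
    | succ n ih => simp only [pathProd, ih (by omega), hk_early n (by omega), mul_one]
  have main : pathProd (fun b => U b * k b) c (P.L - 1 + 1) = pathProd U c (P.L - 1 + 1) * g c := by
    simp only [pathProd, h1 _ le_rfl, hk_last, mul_assoc]
  have hL : P.L - 1 + 1 = P.L := by have := P.hL.2; omega
  simpa only [axialAvg, hL] using main

/-- Right-multiplying the bond variables by a field `k` which is `1` ON EVERY LINE does not change the axial average. [folklore] -/
theorem axialAvg_mul_offLine (U : GaugeField P j G) (k : PBond P j → G)
    (hk : ∀ (c : PBond P (j+1)) (t : ℕ), t < P.L → k (line c t) = 1) :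
    axialAvg (fun b => U b * k b) = axialAvg U := by
  funext c
  have h1 : ∀ n, n ≤ P.L → pathProd (fun b => U b * k b) c n = pathProd U c n := by
    intro n hn
    induction n with
    | zero => rfl
    | succ n ih => simp only [pathProd, ih (by omega), hk c n (by omega), mul_one]
  exact h1 _ le_rfl

variable [MeasurableSpace G] [MeasurableMul₂ G]

/-- The partial transports are measurable functions of the field. [folklore] -/
theorem measurable_pathProd (c : PBond P (j+1)) (n : ℕ) : Measurable (fun U : GaugeField P j G => pathProd U c n) := by
  induction n with
  | zero => exact measurable_const
  | succ n ih =>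
    simp only [pathProd]
    exact ih.mul (measurable_pi_apply (line c n))

/-- The axial average is measurable. [folklore] -/
theorem measurable_axialAvg : Measurable (axialAvg : GaugeField P j G → GaugeField P (j+1) G) :=
  measurable_pi_iff.mpr (fun c => measurable_pathProd c P.L)

end Axial

/-! ## 5. Haar compatibility of the axial average and conditional constancy off the lines -/

section HaarCompat

variable {P : Params} {j : ℕ} {G : Type*} [GaugeGroup G] [MeasurableSpace G] [HaarData G] [MeasurableMul₂ G]

/-- HAAR COMPATIBILITY (`∫ dU f(Ū) = ∫ dV f(V)`, the normalisation implicit in B7 (10)/B12 (0.13)) for the axial average: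
the push-forward of product Haar on `T^{(j)}`-fields is product Haar on `T^{(j+1)}`-fields (standing range).  Proof: the
push-forward is invariant under right translations (translate the last bond of each line, `axialAvg_mul_last`), product
Haar is left-invariant, and a right-invariant finite measure is a multiple of a left-invariant probability
(`measure_eq_mass_smul_of_invariant`). [folklore] -/
theorem map_axialAvg (hj : j + 1 ≤ P.m + P.K) :
    (fieldMeasure P j G).map (axialAvg : GaugeField P j G → GaugeField P (j+1) G) = fieldMeasure P (j+1) G := by
  letI : Group (GaugeField P (j+1) G) := Pi.group
  letI : MeasurableMul₂ (GaugeField P (j+1) G) := Pi.measurableMul₂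
  have hmeas : Measurable (axialAvg : GaugeField P j G → GaugeField P (j+1) G) := measurable_axialAvg
  have h := measure_eq_mass_smul_of_invariant (fieldMeasure P (j+1) G)
    ((fieldMeasure P j G).map (axialAvg : GaugeField P j G → GaugeField P (j+1) G)) ?_ ?_
  · rw [h, Measure.map_apply hmeas MeasurableSet.univ, Set.preimage_univ, measure_univ, one_smul]
  · intro g
    exact (measurePreserving_mulLeft (P := P) (j := j+1) g).map_eq
  · intro g
    set R : GaugeField P j G → GaugeField P j G := fun U b =>
      U b * Function.extend (fun c : PBond P (j+1) => line c (P.L - 1)) g (fun _ => 1) b with hR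
    have hRmp : MeasurePreserving R (fieldMeasure P j G) (fieldMeasure P j G) := measurePreserving_mulRight _
    have hcomp : ((fun x => x * g) ∘ (axialAvg : GaugeField P j G → GaugeField P (j+1) G)) = axialAvg ∘ R := by
      funext U
      show (fun c => axialAvg U c * g c) = axialAvg (R U)
      rw [hR, axialAvg_mul_last hj]
    calc ((fieldMeasure P j G).map axialAvg).map (fun x => x * g)
        = (fieldMeasure P j G).map ((fun x => x * g) ∘ axialAvg) := Measure.map_map (measurable_mul_const g) hmeas
      _ = (fieldMeasure P j G).map (axialAvg ∘ R) := by rw [hcomp]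
      _ = ((fieldMeasure P j G).map R).map axialAvg := (Measure.map_map hmeas hRmp.measurable).symm
      _ = (fieldMeasure P j G).map axialAvg := by rw [hRmp.map_eq]

/-- The axial average is measure preserving `(dU) → (dV)` (standing range). [folklore] -/
theorem measurePreserving_axialAvg (hj : j + 1 ≤ P.m + P.K) :
    MeasurePreserving (axialAvg : GaugeField P j G → GaugeField P (j+1) G) (fieldMeasure P j G) (fieldMeasure P (j+1) G) :=
  ⟨measurable_axialAvg, map_axialAvg hj⟩

/-- CONDITIONAL CONSTANCY OFF THE LINES: conditioning `dU` on the event `{U(b') ∈ A}` of the off-line bond `b'` does not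
change the law of the axial average except for the total mass `Haar(A)` (standing range, `d ≥ 2`).  Proof: for each
measurable set `E` of coarse fields the measure `A ↦ dU(Ū ∈ E, U(b') ∈ A)` on `G` is right-invariant (translate the
variable of `b'`, which no line sees) and finite, hence `dU(Ū ∈ E)·Haar(A)`. [folklore] -/
theorem restrict_map_axialAvg (hj : j + 1 ≤ P.m + P.K) (hd : 2 ≤ P.d) (A : Set G) (hA : MeasurableSet A) :
    ((fieldMeasure P j G).restrict {U : GaugeField P j G | U (offBond P hd j) ∈ A}).map
        (axialAvg : GaugeField P j G → GaugeField P (j+1) G)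
      = (HaarData.haar A) • (fieldMeasure P j G).map (axialAvg : GaugeField P j G → GaugeField P (j+1) G) := by
  classical
  have hmeas : Measurable (axialAvg : GaugeField P j G → GaugeField P (j+1) G) := measurable_axialAvg
  have hev : Measurable (fun U : GaugeField P j G => U (offBond P hd j)) := measurable_pi_apply _
  ext E hE
  rw [Measure.map_apply hmeas hE, Measure.restrict_apply (hmeas hE), Measure.smul_apply,
    Measure.map_apply hmeas hE, smul_eq_mul]
  set F : Set (GaugeField P j G) := axialAvg ⁻¹' E with hF
  have hFm : MeasurableSet F := hmeas hE
  -- the measure `A ↦ dU (F ∩ {U b' ∈ A})` on `G`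
  set κ : Measure G := ((fieldMeasure P j G).restrict F).map (fun U : GaugeField P j G => U (offBond P hd j)) with hκdef
  have hκ : ∀ g : G, κ.map (fun x => x * g) = κ := by
    intro g
    set k : PBond P j → G := Function.update (fun _ => (1 : G)) (offBond P hd j) g with hkdef
    have hk1 : ∀ (c : PBond P (j+1)) (t : ℕ), t < P.L → k (line c t) = 1 := fun c t ht => by
      rw [hkdef, Function.update_of_ne (line_ne_offBond hj hd c ht)]
    have hkb : k (offBond P hd j) = g := by rw [hkdef, Function.update_self]
    set R : GaugeField P j G → GaugeField P j G := fun U b => U b * k b with hR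
    have hRmp : MeasurePreserving R (fieldMeasure P j G) (fieldMeasure P j G) := measurePreserving_mulRight _
    have hRF : R ⁻¹' F = F := by
      ext U
      simp only [hF, Set.mem_preimage]
      rw [show axialAvg (R U) = axialAvg U from axialAvg_mul_offLine U k hk1]
    have hRres : MeasurePreserving R ((fieldMeasure P j G).restrict F) ((fieldMeasure P j G).restrict F) := by
      have := hRmp.restrict_preimage hFm
      rwa [hRF] at this
    have hcomp : ((fun x => x * g) ∘ fun U : GaugeField P j G => U (offBond P hd j))
        = (fun U : GaugeField P j G => U (offBond P hd j)) ∘ R := by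
      funext U
      show U (offBond P hd j) * g = U (offBond P hd j) * k (offBond P hd j)
      rw [hkb]
    calc κ.map (fun x => x * g)
        = ((fieldMeasure P j G).restrict F).map ((fun x => x * g) ∘ fun U : GaugeField P j G => U (offBond P hd j)) :=
          Measure.map_map (measurable_mul_const g) hev
      _ = ((fieldMeasure P j G).restrict F).map ((fun U : GaugeField P j G => U (offBond P hd j)) ∘ R) := by rw [hcomp]
      _ = (((fieldMeasure P j G).restrict F).map R).map (fun U : GaugeField P j G => U (offBond P hd j)) :=
          (Measure.map_map hev hRres.measurable).symm
      _ = κ := by rw [hRres.map_eq]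
  have key := measure_eq_mass_smul_of_invariant (HaarData.haar (G := G)) κ HaarData.map_mul_left hκ
  have hκA : κ A = (fieldMeasure P j G) (F ∩ {U : GaugeField P j G | U (offBond P hd j) ∈ A}) := by
    rw [hκdef, Measure.map_apply hev hA, Measure.restrict_apply (hev hA), Set.inter_comm]; rfl
  have hκu : κ Set.univ = (fieldMeasure P j G) F := by
    rw [hκdef, Measure.map_apply hev MeasurableSet.univ, Set.preimage_univ, Measure.restrict_apply MeasurableSet.univ,
      Set.univ_inter]
  rw [← hκA, key, Measure.smul_apply, smul_eq_mul, hκu, mul_comm]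

/-- Integral form of conditional constancy, the shape consumed by `exists_not_isRT`. [folklore] -/
theorem setIntegral_comp_axialAvg (hj : j + 1 ≤ P.m + P.K) (hd : 2 ≤ P.d) (A : Set G) (hA : MeasurableSet A)
    (f : GaugeField P (j+1) G → ℝ) (hf : Measurable f) :
    ∫ U in {U : GaugeField P j G | U (offBond P hd j) ∈ A}, f (axialAvg U) ∂(fieldMeasure P j G)
      = (HaarData.haar A).toReal * ∫ U, f (axialAvg U) ∂(fieldMeasure P j G) := by
  have hmeas : Measurable (axialAvg : GaugeField P j G → GaugeField P (j+1) G) := measurable_axialAvg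
  rw [← integral_map (hmeas.aemeasurable) hf.aestronglyMeasurable,
    ← integral_map (hmeas.aemeasurable) hf.aestronglyMeasurable, restrict_map_axialAvg hj hd A hA,
    integral_smul_measure, smul_eq_mul]

end HaarCompat

/-! ## 6. `RTOp` over the axial average is uninhabited -/

section AxialEmptiness

variable {P : Params} {j : ℕ} {G : Type*} [GaugeGroup G] [MeasurableSpace G] [HaarData G] [MeasurableMul₂ G]

/-- VACUITY CERTIFICATE FOR `RTOp` (GAPS G-f1-3, DIVERGENCE F17).  In the standing range and `d ≥ 2`, for ANY `Averaging`
whose operation is the axial average, `RTOp P j G av` is EMPTY as soon as the gauge group carries a Haar-measurable set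
of measure strictly between `0` and `1` and a finite, measurable, non-negative, NON-INTEGRABLE function (both exist for
every non-trivial compact connected Lie group, e.g. `SU(N)`, `N ≥ 2`; neither exists for a finite group, where every
density is integrable and `RTOp` is harmless).  Hence the hypothesis `T : ∀ k, RTOp P k G (av k)` of `Step.DensityRG`,
`B14Cor3.partitionFn_le_of_repr218`, … is unsatisfiable for such `G` once some `av k`, `k + 1 ≤ m + K`, is the axial
average: those theorems are correct but, for that averaging, vacuous. [folklore] -/
theorem isEmpty_rtOp_axial (hj : j + 1 ≤ P.m + P.K) (hd : 2 ≤ P.d) (av : Averaging P j G)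
    (hav : av.avg = axialAvg)
    (A : Set G) (hA : MeasurableSet A) (hA0 : HaarData.haar A ≠ 0) (hA1 : HaarData.haar A ≠ 1)
    (h₀ : G → ℝ) (h₀m : Measurable h₀) (h₀nn : ∀ g, 0 ≤ h₀ g) (h₀ni : ¬ Integrable h₀ (HaarData.haar (G := G))) :
    IsEmpty (RTOp P j G av) := by
  have hL := P.hL.2
  -- the coarse bond whose variable carries the non-integrable function
  let c₀ : PBond P (j+1) := ⟨fun _ => 0, ⟨0, by omega⟩⟩
  have hev : MeasurePreserving (fun V : GaugeField P (j+1) G => V c₀) (fieldMeasure P (j+1) G) HaarData.haar :=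
    measurePreserving_eval c₀
  have hp0 : 0 < (HaarData.haar A).toReal := ENNReal.toReal_pos hA0 (measure_ne_top _ _)
  have hp1 : (HaarData.haar A).toReal < 1 := by
    have hlt : HaarData.haar A < 1 := lt_of_le_of_ne prob_le_one hA1
    have := (ENNReal.toReal_lt_toReal (measure_ne_top _ _) ENNReal.one_ne_top).mpr hlt
    simpa using this
  refine isEmpty_rtOp_of_witnesses av (hav ▸ measurable_axialAvg) (hav ▸ map_axialAvg hj)
    {U : GaugeField P j G | U (offBond P hd j) ∈ A} (measurable_pi_apply _ hA)
    (HaarData.haar A).toReal hp0 hp1 ?_ (fun V => h₀ (V c₀)) (h₀m.comp (measurable_pi_apply c₀)) (fun V => h₀nn _) ?_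
  · intro f hf _
    rw [hav]
    exact setIntegral_comp_axialAvg hj hd A hA f hf
  · intro hint
    exact h₀ni ((hev.integrable_comp h₀m.aestronglyMeasurable).mp hint)

/-- The Π-family form actually consumed downstream (`T : ∀ k, RTOp P k G (av k)`): uninhabited as soon as one level in the
standing range averages axially (same witnesses on `G`). [folklore] -/
theorem isEmpty_rtOp_family (av : ∀ k, Averaging P k G) (k₀ : ℕ) (hk₀ : k₀ + 1 ≤ P.m + P.K) (hd : 2 ≤ P.d)
    (hav : (av k₀).avg = axialAvg)
    (A : Set G) (hA : MeasurableSet A) (hA0 : HaarData.haar A ≠ 0) (hA1 : HaarData.haar A ≠ 1)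
    (h₀ : G → ℝ) (h₀m : Measurable h₀) (h₀nn : ∀ g, 0 ≤ h₀ g) (h₀ni : ¬ Integrable h₀ (HaarData.haar (G := G))) :
    IsEmpty (∀ k, RTOp P k G (av k)) := by
  have hk := isEmpty_rtOp_axial hk₀ hd (av k₀) hav A hA hA0 hA1 h₀ h₀m h₀nn h₀ni
  exact ⟨fun T => hk.false (T k₀)⟩

end AxialEmptiness

/-! ## 7. The integrable-density renormalization transformation: `RTOpI` is inhabited -/

section Inhabited

variable {P : Params} {j : ℕ} {G : Type*} [GaugeGroup G] [MeasurableSpace G] [HaarData G]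

/-- Push-forward under the averaging of the measure `φ⁺ dU` (`φ⁺ = max φ 0`). [folklore] -/
noncomputable def pushDensity (avg : GaugeField P j G → GaugeField P (j+1) G) (φ : Density P j G) :
    Measure (GaugeField P (j+1) G) :=
  ((fieldMeasure P j G).withDensity (fun U => ENNReal.ofReal (φ U))).map avg

/-- A version of the Radon–Nikodym derivative `d(avg_* (φ⁺ dU)) / dV`, as a real density. [folklore] -/
noncomputable def rnDensity (avg : GaugeField P j G → GaugeField P (j+1) G) (φ : Density P j G) : Density P (j+1) G :=
  fun V => ((pushDensity avg φ).rnDeriv (fieldMeasure P (j+1) G) V).toReal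

/-- `rnDensity ≥ 0` pointwise. [folklore] -/
theorem rnDensity_nonneg (avg : GaugeField P j G → GaugeField P (j+1) G) (φ : Density P j G) (V : GaugeField P (j+1) G) :
    0 ≤ rnDensity avg φ V := ENNReal.toReal_nonneg

/-- THE RADON–NIKODYM IDENTITY: for an integrable `φ` and a Haar-compatible measurable averaging,
`∫ dV (d avg_*(φ⁺dU)/dV)(V) f(V) = ∫ dU φ⁺(U) f(Ū)` for bounded measurable `f`, with integrability of the left integrand. [folklore] -/
theorem integral_rnDensity_mul (avg : GaugeField P j G → GaugeField P (j+1) G) (havg : Measurable avg)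
    (hmap : (fieldMeasure P j G).map avg = fieldMeasure P (j+1) G)
    (φ : Density P j G) (hφ : Integrable φ (fieldMeasure P j G))
    (f : GaugeField P (j+1) G → ℝ) (hf : Measurable f) (C : ℝ) (hC : ∀ V, |f V| ≤ C) :
    Integrable (fun V => rnDensity avg φ V * f V) (fieldMeasure P (j+1) G) ∧
      ∫ V, rnDensity avg φ V * f V ∂(fieldMeasure P (j+1) G)
        = ∫ U, max (φ U) 0 * f (avg U) ∂(fieldMeasure P j G) := by
  haveI : IsFiniteMeasure ((fieldMeasure P j G).withDensity fun U => ENNReal.ofReal (φ U)) :=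
    isFiniteMeasure_withDensity_ofReal hφ.hasFiniteIntegral
  haveI : IsFiniteMeasure (pushDensity avg φ) := by unfold pushDensity; infer_instance
  have hac : pushDensity avg φ ≪ fieldMeasure P (j+1) G := by
    have := (withDensity_absolutelyContinuous (fieldMeasure P j G) (fun U => ENNReal.ofReal (φ U))).map havg
    rwa [hmap] at this
  have hfi : Integrable f (pushDensity avg φ) := integrable_of_abs_le hf C hC
  refine ⟨(integrable_toReal_rnDeriv_mul_iff hac).mpr hfi, ?_⟩
  show ∫ V, ((pushDensity avg φ).rnDeriv (fieldMeasure P (j+1) G) V).toReal * f V ∂(fieldMeasure P (j+1) G) = _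
  rw [integral_toReal_rnDeriv_mul hac]
  unfold pushDensity
  rw [integral_map havg.aemeasurable hf.aestronglyMeasurable,
    integral_withDensity_eq_integral_toReal_smul₀ hφ.aemeasurable.ennreal_ofReal
      (Filter.Eventually.of_forall fun _ => ENNReal.ofReal_lt_top)]
  simp only [ENNReal.toReal_ofReal', smul_eq_mul]

open Classical in
/-- THE INTEGRABLE-DENSITY RENORMALIZATION TRANSFORMATION `T_avg ρ := dρ⁺_*/dV − dρ⁻_*/dV` (difference of versions of the
Radon–Nikodym derivatives of the push-forwards of `ρ^± dU`; for `ρ ≥ 0` the version with the (a.e. vanishing) second term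
dropped, so that positivity holds POINTWISE as `RTOpI.pos` asks). [cite: Balaban1987RG1, (0.13) p.254] -/
noncomputable def rnTransport (avg : GaugeField P j G → GaugeField P (j+1) G) (ρ : Density P j G) : Density P (j+1) G :=
  fun V => if (∀ U, 0 ≤ ρ U) then rnDensity avg ρ V else rnDensity avg ρ V - rnDensity avg (fun U => - ρ U) V

/-- Positivity of `rnTransport`, pointwise. [folklore] -/
theorem rnTransport_nonneg (avg : GaugeField P j G → GaugeField P (j+1) G) (ρ : Density P j G) (h0 : ∀ U, 0 ≤ ρ U)
    (V : GaugeField P (j+1) G) : 0 ≤ rnTransport avg ρ V := by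
  simp only [rnTransport, if_pos h0]
  exact rnDensity_nonneg avg ρ V

/-- `rnTransport avg ρ` IS a renormalization transform of every INTEGRABLE density `ρ` (the push-forward identity `IsRT`),
for a measurable Haar-compatible averaging. [cite: Balaban1987RG1, (0.13) p.254] -/
theorem isRT_rnTransport (avg : GaugeField P j G → GaugeField P (j+1) G) (havg : Measurable avg)
    (hmap : (fieldMeasure P j G).map avg = fieldMeasure P (j+1) G)
    (ρ : Density P j G) (hρ : Integrable ρ (fieldMeasure P j G)) : IsRT avg ρ (rnTransport avg ρ) := by
  intro f hf hfC
  obtain ⟨C, hC⟩ := hfC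
  have hp := integral_rnDensity_mul avg havg hmap ρ hρ f hf C hC
  have hn := integral_rnDensity_mul avg havg hmap (fun U => - ρ U) hρ.neg f hf C hC
  have hfb : ∀ U, ‖f (avg U)‖ ≤ C := fun U => by simpa [Real.norm_eq_abs] using hC (avg U)
  have I1 : Integrable (fun U => max (ρ U) 0 * f (avg U)) (fieldMeasure P j G) :=
    hρ.pos_part.mul_bdd (hf.comp havg).aestronglyMeasurable (Filter.Eventually.of_forall hfb)
  have I2 : Integrable (fun U => max (- ρ U) 0 * f (avg U)) (fieldMeasure P j G) :=
    hρ.neg_part.mul_bdd (hf.comp havg).aestronglyMeasurable (Filter.Eventually.of_forall hfb)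
  by_cases h0 : ∀ U, 0 ≤ ρ U
  · simp only [rnTransport, if_pos h0]
    rw [hp.2]
    congr 1
    funext U
    rw [max_eq_left (h0 U)]
  · simp only [rnTransport, if_neg h0, sub_mul]
    rw [integral_sub hp.1 hn.1, hp.2, hn.2, ← integral_sub I1 I2]
    congr 1
    funext U
    rw [← sub_mul, max_zero_sub_max_neg_zero_eq_self]

/-- CONSISTENCY CERTIFICATE FOR `RTOpI` (Setup v1.3): every measurable, Haar-compatible averaging carries an integrable-density
renormalization transformation. [cite: Balaban1987RG1, (0.13) p.254] -/
noncomputable def rtOpIOfCompatible (av : Averaging P j G) (havg : Measurable av.avg)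
    (hmap : (fieldMeasure P j G).map av.avg = fieldMeasure P (j+1) G) : RTOpI P j G av where
  T := rnTransport av.avg
  isRT := fun ρ hρ => isRT_rnTransport av.avg havg hmap ρ hρ
  pos := fun ρ h0 V => rnTransport_nonneg av.avg ρ h0 V

variable [MeasurableMul₂ G]

/-- The integrable-density renormalization transformation of the AXIAL average (standing range). [cite: Balaban1987RG1, (0.13) p.254] -/
noncomputable def rtOpIAxial (hj : j + 1 ≤ P.m + P.K) : RTOpI P j G axial :=
  rtOpIOfCompatible axial (by rw [axial_avg]; exact measurable_axialAvg) (by rw [axial_avg]; exact map_axialAvg hj)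

/-- `RTOpI P j G axial` is inhabited in the standing range — while `RTOp P j G axial` is empty (`isEmpty_rtOp_axial`). [folklore] -/
theorem nonempty_rtOpI_axial (hj : j + 1 ≤ P.m + P.K) : Nonempty (RTOpI P j G (axial : Averaging P j G)) :=
  ⟨rtOpIAxial hj⟩

end Inhabited

/-! ## 8. Out of range the UNGUARDED averaging axioms (Setup ≤ v1.2) are unsatisfiable -/

section OutOfRange

variable {P : Params} {j : ℕ}

/-- Beyond the coarsest level both tori have two sites per direction. [folklore] -/
lemma sitesPerDir_of_le (hj : P.m + P.K ≤ j) : P.sitesPerDir j = 2 := by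
  simp [Params.sitesPerDir, Nat.sub_eq_zero_of_le hj]

/-- Beyond the coarsest level every label is `< 2 ≤ L`, so `blockOf ≡ 0`. [folklore] -/
lemma blockOf_eq_zero_of_le (hj : P.m + P.K ≤ j) (x : Site P j) : blockOf x = fun _ => 0 := by
  funext μ
  have hx : (x μ).val < 2 := by
    have h1 := ZMod.val_lt (x μ)
    have h2 := sitesPerDir_of_le (P := P) hj
    omega
  have hL := P.hL.2
  obtain ⟨k, hk⟩ := P.hL.1
  simp only [blockOf, Nat.div_eq_of_lt (show (x μ).val < P.L by omega), Nat.cast_zero]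

variable {G : Type*} [GaugeGroup G]

/-- VACUITY CERTIFICATE FOR THE UNGUARDED `Averaging` (Setup v1.0–v1.2; GAPS G-f1-3, DIVERGENCE F16): for a non-trivial
gauge group, `d ≥ 2` and a level `j ≥ m + K` (where `T^{(j)}` and `T^{(j+1)}` both degenerate to `2` sites per direction and
`emb` is no longer compatible with `blockOf`), NO operation satisfies covariance (B7 (11)) and locality together; hence the
hypothesis `av : ∀ j, Averaging P j G` of `Flow`, `FiniteEpsData`, … was unsatisfiable before the v1.3 range guard.  Witness:
a coarse bond `c` avoiding the site `0 = blockOf(everything)`, for which locality makes `Ū(c)` constant and covariance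
then forces `u(emb c₋) = u(emb c₊)`-invariance for all `u`, while `emb c₋ ≠ emb c₊` (parity, `L` odd). [folklore] -/
theorem no_unguarded_averaging [Nontrivial G] (hd : 2 ≤ P.d) (hj : P.m + P.K ≤ j) :
    ¬ ∃ avg : GaugeField P j G → GaugeField P (j+1) G,
      (∀ (u : GaugeTransf P j G) (U : GaugeField P j G),
          avg (GaugeField.gaugeAct u U) = GaugeField.gaugeAct (fun y => u (emb y)) (avg U)) ∧
      (∀ (U U' : GaugeField P j G) (c : PBond P (j+1)),
          (∀ b : PBond P j, (blockOf b.src = c.src ∨ blockOf b.src = c.tgt) → U b = U' b) → avg U c = avg U' c) := by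
  classical
  rintro ⟨avg, hcov, hloc⟩
  have hL := P.hL.2
  obtain ⟨k, hk⟩ := P.hL.1
  obtain ⟨g, hg⟩ := exists_ne (1 : G)
  -- directions μ₀ = e_0 (of the bond) and ν₁ = e_1 (where the bond sits at label 1)
  let μ₀ : Fin P.d := ⟨0, by omega⟩
  let ν₁ : Fin P.d := ⟨1, by omega⟩
  have hne : ν₁ ≠ μ₀ := fun h => by simp [μ₀, ν₁, Fin.ext_iff] at h
  let y : Site P (j+1) := fun ν => if ν = ν₁ then 1 else 0
  let c : PBond P (j+1) := ⟨y, μ₀⟩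
  have hy1 : c.src ν₁ = 1 := by simp [c, y]
  have ht1 : c.tgt ν₁ = 1 := by simp [c, y, PBond.tgt, Site.shift, Function.update_of_ne hne]
  have h01 : (0 : ZMod (P.sitesPerDir (j+1))) ≠ 1 := zero_ne_one
  -- locality: no fine bond sees `c`, so `avg · c` is constant
  have hconst : ∀ U U' : GaugeField P j G, avg U c = avg U' c := by
    intro U U'
    refine hloc U U' c fun b hb => ?_
    exfalso
    rw [blockOf_eq_zero_of_le hj] at hb
    rcases hb with hb | hb
    · exact h01 (by simpa [hy1] using congrFun hb ν₁)
    · exact h01 (by simpa [ht1] using congrFun hb ν₁)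
  -- the two line ends are distinct sites of `T^{(j)}` (parity in the direction `μ₀`)
  have hy0 : (c.src μ₀).val = 0 := by simp [c, y, (Ne.symm hne : μ₀ ≠ ν₁)]
  have ht0 : (c.tgt μ₀).val = 1 := by
    simp [c, y, PBond.tgt, Site.shift, (Ne.symm hne : μ₀ ≠ ν₁), ZMod.val_one]
  have hemb : emb c.src ≠ emb c.tgt := by
    intro h
    have h' := congrFun h μ₀
    simp only [emb, hy0, ht0, zero_mul, zero_add, one_mul] at h'
    rw [ZMod.natCast_eq_natCast_iff', sitesPerDir_of_le (by omega : P.m + P.K ≤ j)] at h'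
    omega
  -- covariance with `u = g` at `emb c₋`, `1` elsewhere
  let u : GaugeTransf P j G := Function.update (fun _ => (1 : G)) (emb c.src) g
  have hu1 : u (emb c.src) = g := by simp [u]
  have hu2 : u (emb c.tgt) = 1 := by simp [u, Function.update_of_ne (Ne.symm hemb)]
  have key := congrFun (hcov u (fun _ => 1)) c
  rw [hconst (GaugeField.gaugeAct u fun _ => 1) (fun _ => 1)] at key
  simp only [GaugeField.gaugeAct, hu1, hu2, inv_one, mul_one] at key
  -- key : avg 1 c = g * avg 1 c
  exact hg (mul_right_cancel (a := g) (b := avg (fun _ => 1) c) (by rw [← key, one_mul]))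

/-- Hence, WITHOUT the range guard, the family hypothesis `∀ j, Averaging P j G` would be empty (`j := m + K`): the
structure below is `Averaging` of Setup v1.2 verbatim. [folklore] -/
structure AveragingUnguarded (P : Params) (j : ℕ) (G : Type*) [GaugeGroup G] where
  avg : GaugeField P j G → GaugeField P (j+1) G
  covariant : ∀ (u : GaugeTransf P j G) (U : GaugeField P j G),
    avg (GaugeField.gaugeAct u U) = GaugeField.gaugeAct (fun y => u (emb y)) (avg U)
  local_dep : ∀ (U U' : GaugeField P j G) (c : PBond P (j+1)),
    (∀ b : PBond P j, (blockOf b.src = c.src ∨ blockOf b.src = c.tgt) → U b = U' b) → avg U c = avg U' c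

/-- The v1.2 family type is empty for non-trivial `G` and `d ≥ 2`. [folklore] -/
theorem isEmpty_averagingUnguarded_family [Nontrivial G] (hd : 2 ≤ P.d) :
    IsEmpty (∀ j, AveragingUnguarded P j G) :=
  ⟨fun av => no_unguarded_averaging (G := G) hd (le_refl (P.m + P.K))
    ⟨(av (P.m + P.K)).avg, (av (P.m + P.K)).covariant, (av (P.m + P.K)).local_dep⟩⟩

/-- … while the v1.3 (guarded) family type is inhabited (`nonempty_averaging_family`) and every v1.3 `Averaging` in the
standing range satisfies the unguarded axioms. [folklore] -/
def Averaging.toUnguarded (hj : j + 1 ≤ P.m + P.K) (av : Averaging P j G) : AveragingUnguarded P j G :=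
  ⟨av.avg, av.covariant hj, av.local_dep hj⟩

end OutOfRange

/-! ## 9. Beyond the coarsest level: label transport, and a TOTAL Haar-compatible averaging family -/

section Transport

variable {P : Params} {a b : ℕ}

/-- Label transport between two tori of the tower with the same number of sites per direction (used beyond the coarsest
level, where `T^{(k)}` and `T^{(k+1)}` both have `2` sites per direction). [folklore] -/
def siteCast (h : P.sitesPerDir a = P.sitesPerDir b) : Site P a ≃ Site P b where
  toFun x μ := ((x μ).val : ZMod (P.sitesPerDir b))
  invFun x μ := ((x μ).val : ZMod (P.sitesPerDir a))
  left_inv x := by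
    funext μ
    have hlt : (x μ).val < P.sitesPerDir b := h ▸ ZMod.val_lt (x μ)
    simp only [ZMod.val_natCast, Nat.mod_eq_of_lt hlt, ZMod.natCast_zmod_val]
  right_inv x := by
    funext μ
    have hlt : (x μ).val < P.sitesPerDir a := h.symm ▸ ZMod.val_lt (x μ)
    simp only [ZMod.val_natCast, Nat.mod_eq_of_lt hlt, ZMod.natCast_zmod_val]

/-- Bond transport along `siteCast`. [folklore] -/
def bondCast (h : P.sitesPerDir a = P.sitesPerDir b) : PBond P a ≃ PBond P b where
  toFun c := ⟨siteCast h c.src, c.dir⟩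
  invFun c := ⟨(siteCast h).symm c.src, c.dir⟩
  left_inv c := by cases c; simp
  right_inv c := by cases c; simp

variable {j : ℕ} {G : Type*} [GaugeGroup G]

/-- Beyond the coarsest level (`m + K ≤ j`) the fine and coarse tori have equally many sites per direction. [folklore] -/
lemma sitesPerDir_succ_eq_of_le (hj : P.m + P.K ≤ j) : P.sitesPerDir (j+1) = P.sitesPerDir j := by
  rw [sitesPerDir_of_le (P := P) (by omega : P.m + P.K ≤ j + 1), sitesPerDir_of_le hj]

/-- The TRANSPORT "averaging" beyond the coarsest level: `Ū(c) := U(bondCast c)` (a relabelling; no axiom of `Averaging` is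
asked there, v1.3). [folklore] -/
def transportAvg (hj : P.m + P.K ≤ j) (U : GaugeField P j G) : GaugeField P (j+1) G :=
  fun c => U (bondCast (sitesPerDir_succ_eq_of_le hj) c)

/-- A TOTAL averaging family: axial in the standing range, transport beyond it. [folklore] -/
def stdAvg (P : Params) (G : Type*) [GaugeGroup G] (k : ℕ) : Averaging P k G :=
  if hk : k + 1 ≤ P.m + P.K then axial else
    { avg := transportAvg (by omega)
      covariant := fun h => absurd h hk
      local_dep := fun h => absurd h hk }

variable [MeasurableSpace G] [HaarData G] [MeasurableMul₂ G]

omit [GaugeGroup G] [HaarData G] [MeasurableMul₂ G] in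
/-- The transport averaging is measurable. [folklore] -/
theorem measurable_transportAvg (hj : P.m + P.K ≤ j) :
    Measurable (transportAvg hj : GaugeField P j G → GaugeField P (j+1) G) :=
  measurable_pi_iff.mpr fun _ => measurable_pi_apply _

/-- The transport averaging is Haar compatible (same Weil-uniqueness argument as `map_axialAvg`: right translations by
`g` are undone by right translations by `g ∘ bondCast⁻¹`). [folklore] -/
theorem map_transportAvg (hj : P.m + P.K ≤ j) :
    (fieldMeasure P j G).map (transportAvg hj : GaugeField P j G → GaugeField P (j+1) G) = fieldMeasure P (j+1) G := by
  letI : Group (GaugeField P (j+1) G) := Pi.group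
  letI : MeasurableMul₂ (GaugeField P (j+1) G) := Pi.measurableMul₂
  have hmeas : Measurable (transportAvg hj : GaugeField P j G → GaugeField P (j+1) G) := measurable_transportAvg hj
  set e := bondCast (P := P) (sitesPerDir_succ_eq_of_le hj) with he
  have h := measure_eq_mass_smul_of_invariant (fieldMeasure P (j+1) G)
    ((fieldMeasure P j G).map (transportAvg hj : GaugeField P j G → GaugeField P (j+1) G)) ?_ ?_
  · rw [h, Measure.map_apply hmeas MeasurableSet.univ, Set.preimage_univ, measure_univ, one_smul]
  · intro g
    exact (measurePreserving_mulLeft (P := P) (j := j+1) g).map_eq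
  · intro g
    set R : GaugeField P j G → GaugeField P j G := fun U b => U b * g (e.symm b) with hR
    have hRmp : MeasurePreserving R (fieldMeasure P j G) (fieldMeasure P j G) := measurePreserving_mulRight _
    have hcomp : ((fun x => x * g) ∘ (transportAvg hj : GaugeField P j G → GaugeField P (j+1) G)) = transportAvg hj ∘ R := by
      funext U
      show (fun c => transportAvg hj U c * g c) = transportAvg hj (R U)
      funext c
      simp only [transportAvg, hR, ← he, Equiv.symm_apply_apply]
    calc ((fieldMeasure P j G).map (transportAvg hj)).map (fun x => x * g)
        = (fieldMeasure P j G).map ((fun x => x * g) ∘ transportAvg hj) := Measure.map_map (measurable_mul_const g) hmeas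
      _ = (fieldMeasure P j G).map (transportAvg hj ∘ R) := by rw [hcomp]
      _ = ((fieldMeasure P j G).map R).map (transportAvg hj) := (Measure.map_map hmeas hRmp.measurable).symm
      _ = (fieldMeasure P j G).map (transportAvg hj) := by rw [hRmp.map_eq]

/-- `RTOpI` over the transport averaging is inhabited. [folklore] -/
noncomputable def rtOpITransport (hj : P.m + P.K ≤ j) :
    RTOpI P j G ({ avg := transportAvg hj, covariant := fun h => absurd h (by omega),
                   local_dep := fun h => absurd h (by omega) } : Averaging P j G) :=
  rtOpIOfCompatible _ (measurable_transportAvg hj) (map_transportAvg hj)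

/-- JOINT CONSISTENCY CERTIFICATE for the migrated hypotheses of the later modules (`av : ∀ k, Averaging P k G`,
`T : ∀ k, RTOpI P k G (av k)`; GAPS G-f1-3): with the total family `stdAvg`, an integrable-density renormalization
transformation exists AT EVERY LEVEL `k`. [folklore] -/
noncomputable def rtOpIStd (P : Params) (G : Type*) [GaugeGroup G] [MeasurableSpace G] [HaarData G] [MeasurableMul₂ G]
    (k : ℕ) : RTOpI P k G (stdAvg P G k) := by
  by_cases hk : k + 1 ≤ P.m + P.K
  · simp only [stdAvg, dif_pos hk]
    exact rtOpIAxial hk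
  · simp only [stdAvg, dif_neg hk]
    exact rtOpITransport (by omega)

/-- The pair of hypotheses `(av, T)` of `Step.DensityRG`-type structures, in their v1.3 `RTOpI` form, is simultaneously
satisfiable for all levels. [folklore] -/
theorem nonempty_averaging_rtOpI_family :
    ∃ av : ∀ k, Averaging P k G, Nonempty (∀ k, RTOpI P k G (av k)) :=
  ⟨stdAvg P G, ⟨rtOpIStd P G⟩⟩

end Transport

end AveragingRT

end Literature.MathematicalPhysics.QuantumFieldTheory.Balaban1983to89
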